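import Summits.MatrixMultiplication.OmegaCensus.CubeStructureTPP
import Summits.MatrixMultiplication.OmegaCensus.DihedralLikeFamily
import Summits.MatrixMultiplication.OmegaCensus.DicyclicOddCharacters
import HarnessLib

/-!
# No cube law triple in dicyclic-type groups (`c₀ ≠ 0`): the structure theory of cube law shapes is complete

ω-census `pub-omega`, family (b3), seat pub-omega-group gen 7.  Framing: lottery ticket; floor = certified bounds/negative
ranges.  VALUE: a theorem about the group-theoretic method (TPP triples in dihedral-like groups); NOT progress on ω.

Let `G` carry a dihedral-like presentation `ρ, τ : A → G` over a finite abelian group `A`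
(`ρaρb = ρ(a+b)`, `ρaτb = τ(b−a)`, `τaρb = τ(a+b)`, `τaτb = ρ(c₀+b−a)`; automatically `2c₀ = 0`).  `c₀ = 0` is the
generalized dihedral group `Dih(A)`, `c₀ ≠ 0` the generalized dicyclic ("dicyclic-type") groups, e.g. `Q_{4n}`.

**Theorem (`no_cube_law_of_c0_ne_zero`).** If `c₀ ≠ 0`, NO TPP triple `(S, T, U)` with cube coset parts
(`|S₀| = |S₁|`, `|T₀| = |T₁|`, `|U₀| = |U₁|`) attains the law `3|S||T||U| + 8 = 8|A|`.

Hence (`cube_structure_of_law_any`) for EVERY dihedral-like group: a cube law triple forces `c₀ = 0` and then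
`S₁ = κ_S − S₀`, `T₁ = κ_T − T₀`, `U₁ = κ_U − U₀` (`CubeStructureTPP.cube_structure_of_law`).  This closes the item left
open by gen 6 ("the dicyclic-type `c₀ ≠ 0` variant for `c ≥ 2`"): there is nothing to structure, the shapes do not occur —
for every cube shape, dominoes `(1,d,e)` included (so `DominoStructureTPP.domino_structure_of_law` is vacuous at `c₀ ≠ 0`).
The law itself IS attained in dicyclic-type groups (`DicyclicLift.quaternion_volume_ge_law`: `β(Q_{4n}) = 8⌊2n/3⌋`), but
only by non-cube shapes.

**Proof.** The eight vertex near-tilings (`vertex000_charsum` / `vertex111_charsum` for the triple and its three right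
translates by `τ0`, whose parts are `(−c₀ − X₁, −X₀)`) give at a character `ψ` the eight unit equations of
`CubeStructureTPP`, except that the flipped parts carry the sign `γ = ψ(c₀) = ±1`.  Since `c₀ ≠ 0` there is an ODD
character (`γ = −1`).  There (`odd_cube_absurd`): the `2 × 2` mechanism of `CubeStructureChar.unit_pair_dichotomy` becomes
(`unit_pair_odd`) `(|F|² + |H|²)(|u₀|² + |u₁|²) = 2 = (|F|² + |K|²)(|u₀|² + |u₁|²)`, so `|σ₀τ₀| = |σ₁τ₁|`, `|σ₀υ₀| = |σ₁υ₁|`,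
`|τ₀υ₀| = |τ₁υ₁|` and (`CubeHomometric.norms_equal_of_cross`) all three pairs are homometric; the companion cross identities
then give `Re(σ₁σ̄₀·τ₀τ̄₁) = Re(σ₁σ̄₀·υ₀ῡ₁) = Re(τ₁τ̄₀·υ₀ῡ₁) = 0`, impossible for six non-zero sums (two purely imaginary
ratios have a real quotient).  No cube-root obstruction (`3 ∤ |A|`) is needed on this branch.

Data check (seat script `diccube2.py`, definition-level TPP): cube law triples normalised by `0 ∈ S₀, T₀, U₀` number
`24 / 0` in `Dih(ℤ₄) / Q₈`, `1080 / 0` in `D₂₀ / Q₂₀` (shape `(1,1,3)`), `6400 / 0` in `D₃₂ / Q₃₂`, `5120 / 0,0,0` over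
`ℤ₂×ℤ₈` (shape `(1,1,5)`, `c₀ = 0` vs the three `c₀` of order two) — consistent with the theorem.
-/

namespace Summit.MatrixMultiplication.OmegaCensus

open Literature.Combinatorics.Additive Finset

section Core

open ComplexConjugate

/-- The `2 × 2` unit-equation mechanism at an ODD character (`ψ c₀ = −1`, dicyclic type): the flipped equations carry a
sign, and instead of a dichotomy one gets `(H H̄ − K K̄)(u₀v₀ + u₁v₁) = 0` and the cross identity
`(F G − H H̄)(u₀v₀ − u₁v₁) + 2 (F H̄ u₀ v₁ + H G u₁ v₀) = 0`. [folklore] -/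
theorem unit_pair_odd (F H K G Hc Kc u₀ u₁ v₀ v₁ p₁ p₂ q₀ q₇ p₁' p₂' q₀' q₇' : ℂ)
    (hp₁ : p₁ * p₁' = 1) (hp₂ : p₂ * p₂' = 1) (hq₀ : q₀ * q₀' = 1) (hq₇ : q₇ * q₇' = 1)
    (hu1 : F * u₀ + H * u₁ = -p₁) (hu2 : K * u₀ + F * u₁ = -p₂)
    (hu3 : G * u₀ - Kc * u₁ = -q₀) (hu4 : Hc * u₀ - G * u₁ = -q₇)
    (hv1 : G * v₀ + Hc * v₁ = -p₁') (hv2 : Kc * v₀ + G * v₁ = -p₂')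
    (hv3 : F * v₀ - K * v₁ = -q₀') (hv4 : H * v₀ - F * v₁ = -q₇') :
    (H * Hc - K * Kc) * (u₀ * v₀ + u₁ * v₁) = 0 ∧
      (F * G - H * Hc) * (u₀ * v₀ - u₁ * v₁) + 2 * (F * Hc * u₀ * v₁ + H * G * u₁ * v₀) = 0 := by
  have h1 : (F * G + H * Hc) * (u₀ * v₀ + u₁ * v₁) = 2 := by
    linear_combination (G * v₀ + Hc * v₁) * hu1 - p₁ * hv1 + hp₁ + (H * v₀ - F * v₁) * hu4 - q₇ * hv4 + hq₇
  have h2 : (F * G + K * Kc) * (u₀ * v₀ + u₁ * v₁) = 2 := by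
    linear_combination (Kc * v₀ + G * v₁) * hu2 - p₂ * hv2 + hp₂ + (F * v₀ - K * v₁) * hu3 - q₀ * hv3 + hq₀
  refine ⟨by linear_combination h1 - h2, ?_⟩
  linear_combination (G * v₀ + Hc * v₁) * hu1 - p₁ * hv1 + hp₁ - ((H * v₀ - F * v₁) * hu4 - q₇ * hv4 + hq₇)

/-- A homometric pair (`x₀ x̄₀ = x₁ x̄₁`) one of whose members vanishes vanishes entirely; so if the pair cannot vanish
entirely, all four of `x₀, x₁, x̄₀, x̄₁` are non-zero. [folklore] -/
theorem pair_ne_zero_of_homometric {x₀ x₁ cx₀ cx₁ : ℂ} (hcx₀ : cx₀ = conj x₀) (hcx₁ : cx₁ = conj x₁)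
    (H : x₀ * cx₀ = x₁ * cx₁) (hE : x₀ = 0 → x₁ = 0 → False) :
    x₀ ≠ 0 ∧ x₁ ≠ 0 ∧ cx₀ ≠ 0 ∧ cx₁ ≠ 0 := by
  have k₀ : x₀ = 0 → False := fun h0 => by
    have : x₁ * cx₁ = 0 := by rw [← H, h0, zero_mul]
    rw [hcx₁] at this
    exact hE h0 ((mul_conj_eq_zero_iff' x₁).1 this)
  have k₁ : x₁ = 0 → False := fun h1 => by
    have : x₀ * cx₀ = 0 := by rw [H, h1, zero_mul]
    rw [hcx₀] at this
    exact hE ((mul_conj_eq_zero_iff' x₀).1 this) h1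
  refine ⟨k₀, k₁, fun h => k₀ ?_, fun h => k₁ ?_⟩
  · rw [hcx₀] at h; simpa using h
  · rw [hcx₁] at h; simpa using h

/-- **No cube law triple at an odd character.**  The eight vertex unit equations of a cube law triple in a dihedral-like
group read at a character with `ψ c₀ = −1` (`E1 … E8`, the flipped ones carrying the sign `ψ c₀ = −1`) together with their
conjugates `C1 … C8` are contradictory.  Proof: the three odd `2 × 2` viewpoints give `|σ₀τ₀| = |σ₁τ₁|`, `|σ₀υ₀| = |σ₁υ₁|`,
`|τ₀υ₀| = |τ₁υ₁|`, hence homometry of all three pairs (`norms_equal_of_cross`); then the cross identities force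
`Re(σ₁σ̄₀ τ₀τ̄₁) = Re(σ₁σ̄₀ υ₀ῡ₁) = Re(τ₁τ̄₀ υ₀ῡ₁) = 0`, which is impossible for non-zero complex numbers. [folklore] -/
theorem odd_cube_absurd (s₀ s₁ t₀ t₁ u₀ u₁ cs₀ cs₁ ct₀ ct₁ cu₀ cu₁ : ℂ)
    (p₁ p₂ p₃ p₄ p₅ p₆ p₇ p₈ p₁' p₂' p₃' p₄' p₅' p₆' p₇' p₈' : ℂ)
    (hcs₀ : cs₀ = conj s₀) (hcs₁ : cs₁ = conj s₁) (hct₀ : ct₀ = conj t₀) (hct₁ : ct₁ = conj t₁)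
    (hcu₀ : cu₀ = conj u₀) (hcu₁ : cu₁ = conj u₁)
    (hp₁ : p₁ * p₁' = 1) (hp₂ : p₂ * p₂' = 1) (hp₃ : p₃ * p₃' = 1) (hp₄ : p₄ * p₄' = 1)
    (hp₅ : p₅ * p₅' = 1) (hp₆ : p₆ * p₆' = 1) (hp₇ : p₇ * p₇' = 1) (hp₈ : p₈ * p₈' = 1)
    (E1 : s₁ * t₀ * u₀ + s₀ * t₁ * u₀ + s₀ * t₀ * u₁ = -p₁) (E2 : s₀ * t₁ * u₁ + s₁ * t₀ * u₁ + s₁ * t₁ * u₀ = -p₂)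
    (E3 : cs₀ * t₀ * u₀ - cs₁ * t₁ * u₀ - cs₁ * t₀ * u₁ = -p₃) (E4 : -(cs₁ * t₁ * u₁) + cs₀ * t₀ * u₁ + cs₀ * t₁ * u₀ = -p₄)
    (E5 : -(s₁ * ct₁ * u₀) + s₀ * ct₀ * u₀ - s₀ * ct₁ * u₁ = -p₅) (E6 : s₀ * ct₀ * u₁ - s₁ * ct₁ * u₁ + s₁ * ct₀ * u₀ = -p₆)
    (E7 : -(s₁ * t₀ * cu₁) - s₀ * t₁ * cu₁ + s₀ * t₀ * cu₀ = -p₇) (E8 : s₀ * t₁ * cu₀ + s₁ * t₀ * cu₀ - s₁ * t₁ * cu₁ = -p₈)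
    (C1 : cs₁ * ct₀ * cu₀ + cs₀ * ct₁ * cu₀ + cs₀ * ct₀ * cu₁ = -p₁')
    (C2 : cs₀ * ct₁ * cu₁ + cs₁ * ct₀ * cu₁ + cs₁ * ct₁ * cu₀ = -p₂')
    (C3 : s₀ * ct₀ * cu₀ - s₁ * ct₁ * cu₀ - s₁ * ct₀ * cu₁ = -p₃')
    (C4 : -(s₁ * ct₁ * cu₁) + s₀ * ct₀ * cu₁ + s₀ * ct₁ * cu₀ = -p₄')
    (C5 : -(cs₁ * t₁ * cu₀) + cs₀ * t₀ * cu₀ - cs₀ * t₁ * cu₁ = -p₅')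
    (C6 : cs₀ * t₀ * cu₁ - cs₁ * t₁ * cu₁ + cs₁ * t₀ * cu₀ = -p₆')
    (C7 : -(cs₁ * ct₀ * u₁) - cs₀ * ct₁ * u₁ + cs₀ * ct₀ * u₀ = -p₇')
    (C8 : cs₀ * ct₁ * u₀ + cs₁ * ct₀ * u₀ - cs₁ * ct₁ * u₁ = -p₈') : False := by
  have np₁ : p₁ ≠ 0 := fun h => by rw [h, zero_mul] at hp₁; exact zero_ne_one hp₁
  -- the three odd viewpoints
  have VU := unit_pair_odd (s₁ * t₀ + s₀ * t₁) (s₀ * t₀) (s₁ * t₁) (cs₁ * ct₀ + cs₀ * ct₁) (cs₀ * ct₀) (cs₁ * ct₁)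
    u₀ u₁ cu₀ cu₁ p₁ p₂ p₈' p₇' p₁' p₂' p₈ p₇ hp₁ hp₂ (by rw [mul_comm]; exact hp₈) (by rw [mul_comm]; exact hp₇)
    (by linear_combination E1) (by linear_combination E2) (by linear_combination C8) (by linear_combination C7)
    (by linear_combination C1) (by linear_combination C2) (by linear_combination E8) (by linear_combination E7)
  have VT := unit_pair_odd (s₁ * u₀ + s₀ * u₁) (s₀ * u₀) (s₁ * u₁) (cs₁ * cu₀ + cs₀ * cu₁) (cs₀ * cu₀) (cs₁ * cu₁)
    t₀ t₁ ct₀ ct₁ p₁ p₂ p₆' p₅' p₁' p₂' p₆ p₅ hp₁ hp₂ (by rw [mul_comm]; exact hp₆) (by rw [mul_comm]; exact hp₅)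
    (by linear_combination E1) (by linear_combination E2) (by linear_combination C6) (by linear_combination C5)
    (by linear_combination C1) (by linear_combination C2) (by linear_combination E6) (by linear_combination E5)
  have VS := unit_pair_odd (t₁ * u₀ + t₀ * u₁) (t₀ * u₀) (t₁ * u₁) (ct₁ * cu₀ + ct₀ * cu₁) (ct₀ * cu₀) (ct₁ * cu₁)
    s₀ s₁ cs₀ cs₁ p₁ p₂ p₄' p₃' p₁' p₂' p₄ p₃ hp₁ hp₂ (by rw [mul_comm]; exact hp₄) (by rw [mul_comm]; exact hp₃)
    (by linear_combination E1) (by linear_combination E2) (by linear_combination C4) (by linear_combination C3)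
    (by linear_combination C1) (by linear_combination C2) (by linear_combination E4) (by linear_combination E3)
  -- real norms
  set A₀ := Complex.normSq s₀
  set A₁ := Complex.normSq s₁
  set B₀ := Complex.normSq t₀
  set B₁ := Complex.normSq t₁
  set G₀ := Complex.normSq u₀
  set G₁ := Complex.normSq u₁
  have ns₀ : s₀ * cs₀ = (A₀ : ℂ) := by rw [hcs₀, Complex.mul_conj]
  have ns₁ : s₁ * cs₁ = (A₁ : ℂ) := by rw [hcs₁, Complex.mul_conj]
  have nt₀ : t₀ * ct₀ = (B₀ : ℂ) := by rw [hct₀, Complex.mul_conj]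
  have nt₁ : t₁ * ct₁ = (B₁ : ℂ) := by rw [hct₁, Complex.mul_conj]
  have nu₀ : u₀ * cu₀ = (G₀ : ℂ) := by rw [hcu₀, Complex.mul_conj]
  have nu₁ : u₁ * cu₁ = (G₁ : ℂ) := by rw [hcu₁, Complex.mul_conj]
  have A₀nn := Complex.normSq_nonneg s₀; have A₁nn := Complex.normSq_nonneg s₁
  have B₀nn := Complex.normSq_nonneg t₀; have B₁nn := Complex.normSq_nonneg t₁
  have G₀nn := Complex.normSq_nonneg u₀; have G₁nn := Complex.normSq_nonneg u₁
  -- positivity of the pair sums: a vanishing pair kills `E1`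
  have posA : 0 < A₀ + A₁ := by
    by_contra h
    have h0 : A₀ = 0 ∧ A₁ = 0 := by constructor <;> nlinarith
    have hs0 : s₀ = 0 := Complex.normSq_eq_zero.1 h0.1
    have hs1 : s₁ = 0 := Complex.normSq_eq_zero.1 h0.2
    apply np₁; have := E1; rw [hs0, hs1] at this; linear_combination this
  have posB : 0 < B₀ + B₁ := by
    by_contra h
    have h0 : B₀ = 0 ∧ B₁ = 0 := by constructor <;> nlinarith
    have ht0 : t₀ = 0 := Complex.normSq_eq_zero.1 h0.1
    have ht1 : t₁ = 0 := Complex.normSq_eq_zero.1 h0.2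
    apply np₁; have := E1; rw [ht0, ht1] at this; linear_combination this
  have posG : 0 < G₀ + G₁ := by
    by_contra h
    have h0 : G₀ = 0 ∧ G₁ = 0 := by constructor <;> nlinarith
    have hu0 : u₀ = 0 := Complex.normSq_eq_zero.1 h0.1
    have hu1 : u₁ = 0 := Complex.normSq_eq_zero.1 h0.2
    apply np₁; have := E1; rw [hu0, hu1] at this; linear_combination this
  -- the cross relations between the real norms
  have qU' : ((A₀ : ℂ) * B₀ - A₁ * B₁) * (G₀ + G₁) = 0 := by
    rw [← ns₀, ← ns₁, ← nt₀, ← nt₁, ← nu₀, ← nu₁]; linear_combination VU.1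
  have qT' : ((A₀ : ℂ) * G₀ - A₁ * G₁) * (B₀ + B₁) = 0 := by
    rw [← ns₀, ← ns₁, ← nt₀, ← nt₁, ← nu₀, ← nu₁]; linear_combination VT.1
  have qS' : ((B₀ : ℂ) * G₀ - B₁ * G₁) * (A₀ + A₁) = 0 := by
    rw [← ns₀, ← ns₁, ← nt₀, ← nt₁, ← nu₀, ← nu₁]; linear_combination VS.1
  have qU'' : (A₀ * B₀ - A₁ * B₁) * (G₀ + G₁) = 0 := by exact_mod_cast qU'
  have qT'' : (A₀ * G₀ - A₁ * G₁) * (B₀ + B₁) = 0 := by exact_mod_cast qT'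
  have qS'' : (B₀ * G₀ - B₁ * G₁) * (A₀ + A₁) = 0 := by exact_mod_cast qS'
  have qU : A₀ * B₀ = A₁ * B₁ := by
    rcases mul_eq_zero.1 qU'' with h | h
    · linarith
    · linarith
  have qT : A₀ * G₀ = A₁ * G₁ := by
    rcases mul_eq_zero.1 qT'' with h | h
    · linarith
    · linarith
  have qS : B₀ * G₀ = B₁ * G₁ := by
    rcases mul_eq_zero.1 qS'' with h | h
    · linarith
    · linarith
  obtain ⟨hAA, hBB, hGG⟩ := norms_equal_of_cross B₀nn B₁nn G₀nn G₁nn posA posB posG qU qT qS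
  have HS : s₀ * cs₀ = s₁ * cs₁ := by rw [ns₀, ns₁]; exact_mod_cast hAA
  have HT : t₀ * ct₀ = t₁ * ct₁ := by rw [nt₀, nt₁]; exact_mod_cast hBB
  have HU : u₀ * cu₀ = u₁ * cu₁ := by rw [nu₀, nu₁]; exact_mod_cast hGG
  -- all twelve numbers are non-zero
  obtain ⟨zs₀, zs₁, zcs₀, zcs₁⟩ := pair_ne_zero_of_homometric hcs₀ hcs₁ HS fun h0 h1 => np₁ (by
    have := E1; rw [h0, h1] at this; linear_combination this)
  obtain ⟨zt₀, zt₁, zct₀, zct₁⟩ := pair_ne_zero_of_homometric hct₀ hct₁ HT fun h0 h1 => np₁ (by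
    have := E1; rw [h0, h1] at this; linear_combination this)
  obtain ⟨zu₀, zu₁, zcu₀, zcu₁⟩ := pair_ne_zero_of_homometric hcu₀ hcu₁ HU fun h0 h1 => np₁ (by
    have := E1; rw [h0, h1] at this; linear_combination this)
  -- the cross identities under homometry
  have hU3 : t₀ * ct₀ * (s₁ * cs₀ * u₀ * cu₁ + cs₁ * s₀ * cu₀ * u₁) +
      s₀ * cs₀ * (t₁ * ct₀ * u₀ * cu₁ + ct₁ * t₀ * cu₀ * u₁) = 0 := by
    linear_combination (1 / 2 : ℂ) * VU.2 -
      (1 / 2 : ℂ) * ((s₁ * t₀ + s₀ * t₁) * (cs₁ * ct₀ + cs₀ * ct₁) - s₀ * t₀ * (cs₀ * ct₀)) * HU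
  have hT3 : u₀ * cu₀ * (s₁ * cs₀ * t₀ * ct₁ + cs₁ * s₀ * ct₀ * t₁) +
      s₀ * cs₀ * (t₁ * ct₀ * u₀ * cu₁ + ct₁ * t₀ * cu₀ * u₁) = 0 := by
    linear_combination (1 / 2 : ℂ) * VT.2 -
      (1 / 2 : ℂ) * ((s₁ * u₀ + s₀ * u₁) * (cs₁ * cu₀ + cs₀ * cu₁) - s₀ * u₀ * (cs₀ * cu₀)) * HT
  have hS3 : u₀ * cu₀ * (s₁ * cs₀ * t₀ * ct₁ + cs₁ * s₀ * ct₀ * t₁) +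
      t₀ * ct₀ * (s₁ * cs₀ * u₀ * cu₁ + cs₁ * s₀ * cu₀ * u₁) = 0 := by
    linear_combination (1 / 2 : ℂ) * VS.2 -
      (1 / 2 : ℂ) * ((t₁ * u₀ + t₀ * u₁) * (ct₁ * cu₀ + ct₀ * cu₁) - t₀ * u₀ * (ct₀ * cu₀)) * HS
  have hX : u₀ * cu₀ * (s₁ * cs₀ * t₀ * ct₁ + cs₁ * s₀ * ct₀ * t₁) = 0 := by
    linear_combination (1 / 2 : ℂ) * (hS3 + hT3 - hU3)
  have hY : t₀ * ct₀ * (s₁ * cs₀ * u₀ * cu₁ + cs₁ * s₀ * cu₀ * u₁) = 0 := by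
    linear_combination (1 / 2 : ℂ) * (hS3 - hT3 + hU3)
  have hZ : s₀ * cs₀ * (t₁ * ct₀ * u₀ * cu₁ + ct₁ * t₀ * cu₀ * u₁) = 0 := by
    linear_combination (1 / 2 : ℂ) * (hT3 + hU3 - hS3)
  have hα : s₁ * cs₀ * t₀ * ct₁ + cs₁ * s₀ * ct₀ * t₁ = 0 :=
    (mul_eq_zero.1 hX).resolve_left (mul_ne_zero zu₀ zcu₀)
  have hβ : s₁ * cs₀ * u₀ * cu₁ + cs₁ * s₀ * cu₀ * u₁ = 0 :=
    (mul_eq_zero.1 hY).resolve_left (mul_ne_zero zt₀ zct₀)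
  have hδ : t₁ * ct₀ * u₀ * cu₁ + ct₁ * t₀ * cu₀ * u₁ = 0 :=
    (mul_eq_zero.1 hZ).resolve_left (mul_ne_zero zs₀ zcs₀)
  have fin : 2 * (s₀ * cs₀) * (s₁ * cs₁) * (t₁ * ct₀ * u₀ * cu₁) = 0 := by
    linear_combination (s₀ * cs₀ * (s₁ * cs₁)) * hδ + (s₁ * cs₀ * u₀ * cu₁) * hα - (s₁ * cs₀ * t₀ * ct₁) * hβ
  simp [zs₀, zs₁, zcs₀, zcs₁, zt₁, zct₀, zu₀, zcu₁] at fin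

end Core

/-! ## The TPP statement -/

section Vertices

variable {A : Type*} [AddCommGroup A] [DecidableEq A] [Fintype A] {G : Type} [Group G] [DecidableEq G]
  {ρ τ : A → G} {c₀ : A} {S T U : Finset G}

omit [DecidableEq G] in
/-- If `2c₀ = 0 ≠ c₀` there is an odd character (`ψ c₀ = −1`). [folklore] -/
theorem exists_odd_addChar (h2 : c₀ + c₀ = 0) (hc : c₀ ≠ 0) : ∃ ψ : AddChar A ℂ, ψ c₀ = -1 := by
  by_contra hall
  push Not at hall
  have hper : ({(0 : A)} : Finset A).image (fun x => x + c₀) = {0} :=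
    periodic_of_charsum_eq_zero h2 fun ψ hψ => absurd hψ (hall ψ)
  rw [image_singleton, zero_add, singleton_inj] at hper
  exact hc hper

/-- **No cube law triple in a dicyclic-type group.**  Dihedral-like presentation with `c₀ ≠ 0`; a TPP triple with cube
part sizes (`|S₀| = |S₁|`, `|T₀| = |T₁|`, `|U₀| = |U₁|`) never attains `3|S||T||U| + 8 = 8|A|`. [folklore] -/
theorem no_cube_law_of_c0_ne_zero
    (hρρ : ∀ a b, ρ a * ρ b = ρ (a + b)) (hρτ : ∀ a b, ρ a * τ b = τ (b - a))
    (hτρ : ∀ a b, τ a * ρ b = τ (a + b)) (hττ : ∀ a b, τ a * τ b = ρ (c₀ + b - a)) (hc₀ : c₀ ≠ 0)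
    (hρ : Function.Injective ρ) (hτ : Function.Injective τ) (hne : ∀ a b, ρ a ≠ τ b)
    (hsurj : ∀ g, (∃ a, ρ a = g) ∨ (∃ a, τ a = g)) (h : TripleProductProperty S T U)
    (hS : (univ.filter fun a : A => ρ a ∈ S).card = (univ.filter fun a : A => τ a ∈ S).card)
    (hT : (univ.filter fun a : A => ρ a ∈ T).card = (univ.filter fun a : A => τ a ∈ T).card)
    (hU : (univ.filter fun a : A => ρ a ∈ U).card = (univ.filter fun a : A => τ a ∈ U).card) :
    3 * (S.card * T.card * U.card) + 8 ≠ 8 * Fintype.card A := by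
  intro hV
  set S₀ : Finset A := univ.filter fun a => ρ a ∈ S with hS₀
  set S₁ : Finset A := univ.filter fun a => τ a ∈ S with hS₁
  set T₀ : Finset A := univ.filter fun a => ρ a ∈ T with hT₀
  set T₁ : Finset A := univ.filter fun a => τ a ∈ T with hT₁
  set U₀ : Finset A := univ.filter fun a => ρ a ∈ U with hU₀
  set U₁ : Finset A := univ.filter fun a => τ a ∈ U with hU₁
  have h2 : c₀ + c₀ = 0 := two_c0_eq_zero hρτ hτρ hττ hτ
  -- numerics: `|A| = 3 s₀ t₀ u₀ + 1`
  have cS := card_eq_parts' hρ hτ hne hsurj S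
  have cT := card_eq_parts' hρ hτ hne hsurj T
  have cU := card_eq_parts' hρ hτ hne hsurj U
  have hprod : S.card * T.card * U.card = 8 * (S₀.card * T₀.card * U₀.card) := by
    rw [cS, cT, cU, ← hS, ← hT, ← hU]; ring
  rw [hprod] at hV
  have hN : S₀.card * T₀.card * U₀.card + S₀.card * T₀.card * U₀.card + S₀.card * T₀.card * U₀.card + 1 =
      Fintype.card A := by omega
  -- the translated triples and their parts
  have er : (Equiv.mulRight (1 : G)).toEmbedding = Function.Embedding.refl G := by ext x; simp
  have hS' := h.map_mulRight (τ 0) 1 1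
  have hT' := h.map_mulRight 1 (τ 0) 1
  have hU' := h.map_mulRight 1 1 (τ 0)
  simp only [er, Finset.map_refl] at hS' hT' hU'
  have cρ := card_rho_part_mulRight_tau hρρ hρτ hττ (A := A)
  have cτ := card_tau_part_mulRight_tau hρρ hττ (A := A)
  have pρ := rho_part_mulRight_tau hρρ hρτ hττ (A := A)
  have pτ := tau_part_mulRight_tau hρρ hττ (A := A)
  -- the eight vertex identities (with missed points)
  obtain ⟨x₁, E1⟩ := vertex000_charsum hρρ hρτ hτρ hττ hρ hτ hne h (by rw [← hS, ← hT, ← hU]; exact hN)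
  obtain ⟨x₂, E2⟩ := vertex111_charsum hρρ hρτ hτρ hττ hρ hτ hne h (by rw [← hS, ← hT, ← hU]; exact hN)
  obtain ⟨x₃, E3⟩ := vertex000_charsum hρρ hρτ hτρ hττ hρ hτ hne hS' (by rw [cρ, cτ, ← hS, ← hT, ← hU]; exact hN)
  obtain ⟨x₄, E4⟩ := vertex111_charsum hρρ hρτ hτρ hττ hρ hτ hne hS' (by rw [cρ, cτ, ← hS, ← hT, ← hU]; exact hN)
  obtain ⟨x₅, E5⟩ := vertex000_charsum hρρ hρτ hτρ hττ hρ hτ hne hT' (by rw [cρ, cτ, ← hS, ← hT, ← hU]; exact hN)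
  obtain ⟨x₆, E6⟩ := vertex111_charsum hρρ hρτ hτρ hττ hρ hτ hne hT' (by rw [cρ, cτ, ← hS, ← hT, ← hU]; exact hN)
  obtain ⟨x₇, E7⟩ := vertex000_charsum hρρ hρτ hτρ hττ hρ hτ hne hU' (by rw [cρ, cτ, ← hS, ← hT, ← hU]; exact hN)
  obtain ⟨x₈, E8⟩ := vertex111_charsum hρρ hρτ hτρ hττ hρ hτ hne hU' (by rw [cρ, cτ, ← hS, ← hT, ← hU]; exact hN)
  -- rewrite the parts of the translates: ρ-part of X·τ0 = X₁.image (−c₀ − ·), τ-part = X₀.image (− ·)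
  simp only [pρ, pτ] at E3 E4 E5 E6 E7 E8
  -- an odd character
  obtain ⟨ψ, hodd⟩ := exists_odd_addChar (A := A) h2 hc₀
  have hψ : ψ ≠ 0 := by
    intro h0; rw [h0, AddChar.zero_apply] at hodd; norm_num at hodd
  have cj : ∀ X : Finset A, (∑ a ∈ X, ψ (-a)) = (starRingEnd ℂ) (∑ a ∈ X, ψ a) := fun X => (conj_charsum' ψ X).symm
  have cp : ∀ x : A, ψ (-x) = (starRingEnd ℂ) (ψ x) := fun x => AddChar.map_neg_eq_conj ψ x
  have un : ∀ x : A, ψ x * ψ (-x) = 1 := fun x => by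
    rw [← AddChar.map_add_eq_mul, add_neg_cancel, AddChar.map_zero_eq_one]
  have e1 := E1 ψ hψ; have e2 := E2 ψ hψ; have e3 := E3 ψ hψ; have e4 := E4 ψ hψ
  have e5 := E5 ψ hψ; have e6 := E6 ψ hψ; have e7 := E7 ψ hψ; have e8 := E8 ψ hψ
  simp only [charsum_image_neg_sub, charsum_image_neg] at e3 e4 e5 e6 e7 e8
  simp only [neg_shift h2, hodd] at e3 e4 e5 e6 e7 e8
  -- conjugate equations
  have cj' : ∀ X : Finset A, (starRingEnd ℂ) (∑ a ∈ X, ψ (-a)) = ∑ a ∈ X, ψ a := fun X => by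
    rw [cj, starRingEnd_self_apply]
  have c1 := congrArg (starRingEnd ℂ) e1; have c2 := congrArg (starRingEnd ℂ) e2
  have c3 := congrArg (starRingEnd ℂ) e3; have c4 := congrArg (starRingEnd ℂ) e4
  have c5 := congrArg (starRingEnd ℂ) e5; have c6 := congrArg (starRingEnd ℂ) e6
  have c7 := congrArg (starRingEnd ℂ) e7; have c8 := congrArg (starRingEnd ℂ) e8
  simp only [map_add, map_mul, map_neg, map_one, cj', ← cj, ← cp] at c1 c2 c3 c4 c5 c6 c7 c8
  exact odd_cube_absurd (∑ a ∈ S₀, ψ a) (∑ a ∈ S₁, ψ a) (∑ a ∈ T₀, ψ a) (∑ a ∈ T₁, ψ a) (∑ a ∈ U₀, ψ a) (∑ a ∈ U₁, ψ a)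
    (∑ a ∈ S₀, ψ (-a)) (∑ a ∈ S₁, ψ (-a)) (∑ a ∈ T₀, ψ (-a)) (∑ a ∈ T₁, ψ (-a)) (∑ a ∈ U₀, ψ (-a)) (∑ a ∈ U₁, ψ (-a))
    (ψ x₁) (ψ x₂) (ψ x₃) (ψ x₄) (ψ x₅) (ψ x₆) (ψ x₇) (ψ x₈)
    (ψ (-x₁)) (ψ (-x₂)) (ψ (-x₃)) (ψ (-x₄)) (ψ (-x₅)) (ψ (-x₆)) (ψ (-x₇)) (ψ (-x₈))
    (cj S₀) (cj S₁) (cj T₀) (cj T₁) (cj U₀) (cj U₁)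
    (un x₁) (un x₂) (un x₃) (un x₄) (un x₅) (un x₆) (un x₇) (un x₈)
    (by linear_combination e1) (by linear_combination e2) (by linear_combination e3) (by linear_combination e4)
    (by linear_combination e5) (by linear_combination e6) (by linear_combination e7) (by linear_combination e8)
    (by linear_combination c1) (by linear_combination c2) (by linear_combination c3) (by linear_combination c4)
    (by linear_combination c5) (by linear_combination c6) (by linear_combination c7) (by linear_combination c8)

/-- **A cube law triple forces `c₀ = 0`.**  In a dihedral-like group over `A` (any `c₀`), a TPP triple with cube part
sizes attaining `3|S||T||U| + 8 = 8|A|` can only exist when `c₀ = 0` (the group is generalized dihedral). [folklore] -/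
theorem c0_eq_zero_of_cube_law
    (hρρ : ∀ a b, ρ a * ρ b = ρ (a + b)) (hρτ : ∀ a b, ρ a * τ b = τ (b - a))
    (hτρ : ∀ a b, τ a * ρ b = τ (a + b)) (hττ : ∀ a b, τ a * τ b = ρ (c₀ + b - a))
    (hρ : Function.Injective ρ) (hτ : Function.Injective τ) (hne : ∀ a b, ρ a ≠ τ b)
    (hsurj : ∀ g, (∃ a, ρ a = g) ∨ (∃ a, τ a = g)) (h : TripleProductProperty S T U)
    (hS : (univ.filter fun a : A => ρ a ∈ S).card = (univ.filter fun a : A => τ a ∈ S).card)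
    (hT : (univ.filter fun a : A => ρ a ∈ T).card = (univ.filter fun a : A => τ a ∈ T).card)
    (hU : (univ.filter fun a : A => ρ a ∈ U).card = (univ.filter fun a : A => τ a ∈ U).card)
    (hV : 3 * (S.card * T.card * U.card) + 8 = 8 * Fintype.card A) : c₀ = 0 := by
  by_contra hc₀
  exact no_cube_law_of_c0_ne_zero hρρ hρτ hτρ hττ hc₀ hρ hτ hne hsurj h hS hT hU hV

/-- **Structure of cube law triples in ALL dihedral-like groups** (generalized dihedral and dicyclic-type alike): a TPP
triple with cube part sizes attaining `3|S||T||U| + 8 = 8|A|` lives in a generalized dihedral group (`c₀ = 0`) and satisfies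
`S₁ = κ_S − S₀`, `T₁ = κ_T − T₀`, `U₁ = κ_U − U₀`. [folklore] -/
theorem cube_structure_of_law_any
    (hρρ : ∀ a b, ρ a * ρ b = ρ (a + b)) (hρτ : ∀ a b, ρ a * τ b = τ (b - a))
    (hτρ : ∀ a b, τ a * ρ b = τ (a + b)) (hττ : ∀ a b, τ a * τ b = ρ (c₀ + b - a))
    (hρ : Function.Injective ρ) (hτ : Function.Injective τ) (hne : ∀ a b, ρ a ≠ τ b)
    (hsurj : ∀ g, (∃ a, ρ a = g) ∨ (∃ a, τ a = g)) (h : TripleProductProperty S T U)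
    (hS : (univ.filter fun a : A => ρ a ∈ S).card = (univ.filter fun a : A => τ a ∈ S).card)
    (hT : (univ.filter fun a : A => ρ a ∈ T).card = (univ.filter fun a : A => τ a ∈ T).card)
    (hU : (univ.filter fun a : A => ρ a ∈ U).card = (univ.filter fun a : A => τ a ∈ U).card)
    (hV : 3 * (S.card * T.card * U.card) + 8 = 8 * Fintype.card A) :
    c₀ = 0 ∧ ∃ κS κT κU : A,
      (univ.filter fun a : A => τ a ∈ S) = (univ.filter fun a : A => ρ a ∈ S).image (fun b => κS - b) ∧
      (univ.filter fun a : A => τ a ∈ T) = (univ.filter fun a : A => ρ a ∈ T).image (fun b => κT - b) ∧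
      (univ.filter fun a : A => τ a ∈ U) = (univ.filter fun a : A => ρ a ∈ U).image (fun b => κU - b) := by
  have hc₀ := c0_eq_zero_of_cube_law hρρ hρτ hτρ hττ hρ hτ hne hsurj h hS hT hU hV
  exact ⟨hc₀, cube_structure_of_law hρρ hρτ hτρ hττ hc₀ hρ hτ hne hsurj h hS hT hU hV⟩

end Vertices

end Summit.MatrixMultiplication.OmegaCensus
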